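import Summits.BirchSwinnertonDyer.BirchSwinnertonDyer.Theorems.Rank1ResidualJetSection6
import Mathlib.Data.ZMod.Basic
import HarnessLib

/-!
# T1 JET road K — ANTI-VACUITY of the abstract Thm 6.3: the hypotheses of
# `JET.Section6.tamagawaExponent_le_mInfty_of_minimalCoreVertex` are jointly satisfiable with `t = m_∞ = m = 1`

THEOREMS ONLY (seat `bsd-jet-pv-2`, session g2; `--supports stmt-BirchSwinnertonDyer-14418`, helper).
`Rank1ResidualJetSection6.lean` (p471669) proves Jetchev 2008 Thm. 6.3 over ABSTRACT data under a list
of hypotheses (Thm 5.1 at `q` and at `λ`, (δ), core vertex, Lemma 6.1, §3.1 item 7, Prop 4.9,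
Prop 4.7). A theorem with many hypotheses is worthless if they contradict each other; this file records
ONE toy model — `p = 3`, every group `ℤ/3`, `ι = Unit`, identity localisations, `A' = B' = D' = 0`,
`C' = ℤ/3`, `locq = 0`, `locq' =` the inclusion, `sing = 0`, `κ̃ = 1`, `κ = 3·κ̃ (= 0)`,
`κ_{cℓ} = 0` — on which every non-structural hypothesis holds with `t = mInf = m = 1` (so `0 < t`:
the non-trivial branch of the proof is exercised), as ONE conjunction
(`toyThm63Data_hypotheses`), and an `example` (no declaration) feeding it to the theorem. Pattern of
x11b3's `LayerDataAntiVacuity.lean`. Nothing about elliptic curves is asserted; 0 classes move.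
-/

set_option autoImplicit false

noncomputable section

open scoped Classical

namespace Summit.BirchSwinnertonDyer.Rank1Residual.JET.Section6

/-- **The toy model satisfies every hypothesis of `tamagawaExponent_le_mInfty_of_minimalCoreVertex`
with `p = 3`, `m = t = mInf = 1`** — in the order of that theorem's binders: `hker`, `horth_q`,
`hQ'cyc`, `hQ'card`, `h61`, `hsing`, `horth_ℓ`, `hκt`, `h49`, `h47`; and `0 < t`. (`hB'A'`,
`hcore`, `hκ` hold by `rfl` on this data and are not repeated.) [folklore] -/
theorem toyThm63Data_hypotheses :
    (∀ x : (⊤ : AddSubgroup (ZMod 3)),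
        (⊤ : AddSubgroup (ZMod 3)).subtype x = 0 ↔ (x : ZMod 3) ∈ (⊥ : AddSubgroup (ZMod 3))) ∧
      Nat.card (0 : (⊥ : AddSubgroup (ZMod 3)) →+ ZMod 3).range *
          Nat.card ((⊤ : AddSubgroup (ZMod 3)).subtype).range = Nat.card (ZMod 3) ∧
      IsAddCyclic (ZMod 3) ∧ Nat.card (ZMod 3) = 3 ^ 1 ∧
      (∀ (x y : ZMod 3), y ≠ 0 → ∃ _ : Unit,
        addOrderOf (AddMonoidHom.id (ZMod 3) x) = addOrderOf x ∧
          addOrderOf (AddMonoidHom.id (ZMod 3) y) = addOrderOf y) ∧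
      (∀ (_ : Unit) (x : (⊥ : AddSubgroup (ZMod 3))),
        (0 : (⊥ : AddSubgroup (ZMod 3)) →+ ZMod 3) x = 0 ↔ (x : ZMod 3) ∈ (⊥ : AddSubgroup (ZMod 3))) ∧
      (∀ _ : Unit, Nat.card (0 : (⊥ : AddSubgroup (ZMod 3)) →+ ZMod 3).range *
          Nat.card ((⊤ : AddSubgroup (ZMod 3)).map (AddMonoidHom.id (ZMod 3))) = 3 ^ 1) ∧
      addOrderOf (1 : ZMod 3) = 3 ^ 1 ∧
      (∀ _ : Unit, (0 : ZMod 3) ∈ (⊥ : AddSubgroup (ZMod 3))) ∧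
      (∀ _ : Unit, addOrderOf (AddMonoidHom.id (ZMod 3) 0) =
        addOrderOf (AddMonoidHom.id (ZMod 3) ((3 ^ 1 : ℕ) • (1 : ZMod 3)))) ∧
      (0 : ℕ) < 1 := by
  have hcardZ : Nat.card (ZMod 3) = 3 ^ 1 := by simp [Nat.card_eq_fintype_card, ZMod.card]
  have hbot : Nat.card (⊥ : AddSubgroup (ZMod 3)) = 1 := AddSubgroup.card_bot
  have htop : Nat.card (⊤ : AddSubgroup (ZMod 3)) = 3 := by
    rw [AddSubgroup.card_top, Nat.card_eq_fintype_card, ZMod.card]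
  refine ⟨?_, ?_, inferInstance, hcardZ, ?_, ?_, ?_, ?_, fun _ => (⊥ : AddSubgroup _).zero_mem, ?_,
    Nat.one_pos⟩
  · intro x
    simp only [AddSubgroup.coe_subtype, AddSubgroup.mem_bot, ZeroMemClass.coe_eq_zero]
  · rw [AddMonoidHom.range_zero, hbot, AddSubgroup.range_subtype, htop, hcardZ]; norm_num
  · intro x y _
    exact ⟨(), rfl, rfl⟩
  · intro _ x
    simp only [AddMonoidHom.zero_apply, true_iff]
    exact x.2
  · intro _
    rw [AddMonoidHom.range_zero, hbot, AddSubgroup.map_id, htop]; norm_num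
  · rw [pow_one, ZMod.addOrderOf_one]
  · intro _
    have hκ : ((3 ^ 1 : ℕ) • (1 : ZMod 3)) = 0 := by decide
    show addOrderOf (0 : ZMod 3) = addOrderOf ((3 ^ 1 : ℕ) • (1 : ZMod 3))
    rw [hκ]

/-- Sanity (`example`, no declaration): the abstract Thm. 6.3 ELABORATES on the toy model with every
binder discharged by `toyThm63Data_hypotheses` (and `rfl` for `hB'A'`, `hcore`, `hκ`), returning
`t ≤ mInf`, here `1 ≤ 1`. [folklore] -/
example : (1 : ℕ) ≤ 1 := by
  obtain ⟨hker, horth_q, hcyc, hcard, h61, hsing, horth_ℓ, hκt, h49, h47, -⟩ :=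
    toyThm63Data_hypotheses
  exact tamagawaExponent_le_mInfty_of_minimalCoreVertex (p := 3) Nat.prime_three
    (m := 1) (t := 1) (mInf := 1) le_rfl le_rfl (Hp := ZMod 3) (Hm := ZMod 3) (ι := Unit)
    (Lp := fun _ => ZMod 3) (Lm := fun _ => ZMod 3)
    (fun _ => AddMonoidHom.id (ZMod 3)) (fun _ => AddMonoidHom.id (ZMod 3))
    ⊥ ⊥ ⊤ (fun _ => ⊥) le_rfl rfl
    (Q := ZMod 3) (Q' := ZMod 3) (0 : (⊥ : AddSubgroup (ZMod 3)) →+ ZMod 3)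
    ((⊤ : AddSubgroup (ZMod 3)).subtype) hker horth_q hcyc hcard h61
    (S := fun _ => ZMod 3) (fun _ => (0 : (⊥ : AddSubgroup (ZMod 3)) →+ ZMod 3)) hsing horth_ℓ
    (1 : ZMod 3) ((3 ^ 1 : ℕ) • (1 : ZMod 3)) rfl hκt (fun _ => 0) h49 h47

end Summit.BirchSwinnertonDyer.Rank1Residual.JET.Section6

end
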